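import Literature.Geometry.GeometricMeasureTheory.Currents
import Mathlib.Analysis.Normed.Module.Alternating.Curry
import Mathlib.MeasureTheory.Integral.IntervalIntegral.Basic

/-!
# The product current `[a, b] × T` on the cylinder `ℝ × Ω`

Federer 4.1.8 defines the cartesian product `S × T ∈ 𝒟_{j+k}(A × B)` of currents; the case
`S = [a, b] ∈ 𝒟_1(ℝ)` is the one entering the homotopy formula 4.1.9 and the cone construction.
This file constructs, for the currents of `Currents.lean` on an open `Ω ⊆ E`,

* `cylinder Ω : Opens (ℝ × E)` — the cylinder `ℝ × Ω`;
* `covSlice ω`, `covSliceCLM` — contraction of an `(m+1)`-covector on `ℝ × E` with `e₀ = (1, 0)`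
  followed by restriction to `E` (`‖covSlice ω‖ ≤ ‖ω‖`), and **the Cartan-type identity**
  `covSlice_extDeriv : (dφ)(t,·)^E = ι^*(∂ₜφ(t,·)) − d(φ(t,·)^E)` (`ι = inr`), the pointwise
  identity behind `∂([a,b] × T) = δ_b × T − δ_a × T − [a,b] × ∂T`;
* `TestForm.sliceBy L φ t` — the slice `x ↦ L (φ(t, x))` of a test form on the cylinder through a
  continuous linear map `L` on covectors (time slice `φ^t`: `L = covSliceCLM`; pull-back to the
  slice `j_t^* φ`: `L = (· ∘ ⋀ inr)`), a test form on `Ω`; its `𝓓_K`-version `sliceByD` with the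
  seminorm estimates `N_i(sliceByD L φ t) ≤ ‖L‖ N_i(φ)` (`seminorm_sliceByD_le`) and
  `N_i(sliceByD L φ t − sliceByD L φ t') ≤ ‖L‖ sup ‖D^iφ(t,·) − D^iφ(t',·)‖`
  (`seminorm_sliceByD_sub_le`), from `D^i(x ↦ L φ(t,x)) = L ∘ D^iφ(t,x) ∘ (inr,…,inr)`;
* `Current.exists_seminorm_bound` — a current is bounded by finitely many seminorms on each step
  `𝓓_K` (`Seminorm.bound_of_continuous`), whence **`t ↦ T(sliceBy L φ t)` is continuous**
  (`Current.continuous_apply_sliceBy`, uniform continuity of the derivatives of `φ`);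
* `Current.prodInterval a b T : 𝒟_{m+1}(ℝ × Ω)` — **the product current `[a, b] × T`**,
  `([a,b] × T)(φ) = ∫_a^b T(φ^t) dt` (`prodInterval_apply`), a current by the bound
  `|∫_a^b T(φ^t) dt| ≤ |b − a| C (s.sup N_K̃)(φ)` on `𝓓_K̃`.

Not yet here: the boundary formula `∂([a,b] × T) = δ_b × T − δ_a × T − [a,b] × ∂T` (needs the
derivative of `t ↦ T(j_t^* φ)`), the homotopy formula and the mass estimate 4.1.9.

## References

* H. Federer, *Geometric Measure Theory*, Springer 1969, 4.1.8 [Federer1969].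
-/

noncomputable section

open scoped Distributions ENNReal NNReal Topology ContDiff
open MeasureTheory TopologicalSpace Set Filter Metric Function

namespace Literature.Geometry.GeometricMeasureTheory



section CovSlice

variable {E F : Type*} [NormedAddCommGroup E] [NormedSpace ℝ E] [NormedAddCommGroup F]
  [NormedSpace ℝ F] {m : ℕ}

/-- Contract an `(m+1)`-covector on `ℝ × E` with the unit vector `e₀ = (1, 0)` of the `ℝ`-factor and
restrict to `E`: `(ζ^E)(v₁,…,v_m) = ζ(e₀, (0,v₁), …, (0,v_m))`. [cite: Federer1969, 4.1.8] -/
def covSlice (ζ : (ℝ × E) [⋀^Fin (m + 1)]→L[ℝ] F) : E [⋀^Fin m]→L[ℝ] F :=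
  (ζ.curryLeft ((1 : ℝ), (0 : E))).compContinuousLinearMap (ContinuousLinearMap.inr ℝ ℝ E)

/-- `covSlice ζ v = ζ (e₀ :: (0, v))`. [folklore] -/
theorem covSlice_apply (ζ : (ℝ × E) [⋀^Fin (m + 1)]→L[ℝ] F) (v : Fin m → E) :
    covSlice ζ v = ζ (Fin.cons ((1 : ℝ), (0 : E)) fun i => ((0 : ℝ), v i)) := by
  simp [covSlice, ContinuousAlternatingMap.curryLeft_apply_apply, Matrix.vecCons]
  rfl

/-- `covSlice` is linear: as a continuous linear map. [folklore] -/
def covSliceCLM : ((ℝ × E) [⋀^Fin (m + 1)]→L[ℝ] F) →L[ℝ] (E [⋀^Fin m]→L[ℝ] F) :=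
  LinearMap.mkContinuous
    { toFun := covSlice
      map_add' := fun ζ η1 => by ext v; simp [covSlice_apply]
      map_smul' := fun c ζ => by ext v; simp [covSlice_apply] }
    1 fun ζ => by
      rw [one_mul]
      refine (ContinuousAlternatingMap.norm_compContinuousLinearMap_le _ _).trans ?_
      calc ‖ζ.curryLeft ((1 : ℝ), (0 : E))‖ * ‖ContinuousLinearMap.inr ℝ ℝ E‖ ^ Fintype.card (Fin m)
          ≤ (‖ζ.curryLeft‖ * ‖((1 : ℝ), (0 : E))‖) * 1 ^ Fintype.card (Fin m) :=
            mul_le_mul ((ζ.curryLeft).le_opNorm _) (pow_le_pow_left₀ (norm_nonneg _)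
              (ContinuousLinearMap.norm_inr_le_one ℝ ℝ E) _) (by positivity) (by positivity)
        _ = ‖ζ‖ := by
            rw [ContinuousAlternatingMap.norm_curryLeft, one_pow, mul_one, Prod.norm_mk, norm_one,
              norm_zero, max_eq_left zero_le_one, mul_one]

/-- `covSliceCLM ζ = covSlice ζ`. [folklore] -/
@[simp] theorem covSliceCLM_apply (ζ : (ℝ × E) [⋀^Fin (m + 1)]→L[ℝ] F) :
    covSliceCLM ζ = covSlice ζ := rfl

/-- `‖ζ^E‖ ≤ ‖ζ‖`. [folklore] -/
theorem norm_covSlice_le (ζ : (ℝ × E) [⋀^Fin (m + 1)]→L[ℝ] F) : ‖covSlice ζ‖ ≤ ‖ζ‖ := by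
  have h := (covSliceCLM (E := E) (F := F) (m := m)).le_of_opNorm_le
    (LinearMap.mkContinuous_norm_le _ zero_le_one _) ζ
  simpa using h

/-- Removing the `(j+1)`-st entry of `a :: u` keeps the head. [folklore] -/
theorem Fin.removeNth_succ_cons {α : Type*} {n : ℕ} (a : α) (u : Fin (n + 1) → α) (j : Fin (n + 1)) :
    Fin.removeNth j.succ (Fin.cons a u : Fin (n + 2) → α) = Fin.cons a (Fin.removeNth j u) := by
  funext i
  refine Fin.cases ?_ (fun k => ?_) i
  · simp [Fin.removeNth]
  · simp [Fin.removeNth, Fin.succ_succAbove_succ]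

/-- Removing the head of `a :: u` gives `u`. [folklore] -/
theorem Fin.removeNth_zero_cons {α : Type*} {n : ℕ} (a : α) (u : Fin n → α) :
    Fin.removeNth 0 (Fin.cons a u : Fin (n + 1) → α) = u := by
  funext i
  simp [Fin.removeNth]

/-- **The Cartan-type identity for slices**: for a smooth `(m+1)`-form `φ` on `ℝ × E`,
`(dφ)(t,x)^E = ι^* (∂ₜφ(t,x)) − d(φ(t,·)^E)(x)`, where `ι = inr : E → ℝ × E`, `∂ₜφ = Dφ(e₀)` and
`(·)^E = covSlice` (this is `ι_{e₀} d + d ι_{e₀} = ∂ₜ` restricted to `E`). [cite: Federer1969, 4.1.8] -/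
theorem covSlice_extDeriv {φ : ℝ × E → (ℝ × E) [⋀^Fin (m + 1)]→L[ℝ] F} {t : ℝ} {x : E}
    (hφ : ContDiff ℝ 2 φ) :
    covSlice (extDeriv φ (t, x)) =
      (fderiv ℝ φ (t, x) ((1 : ℝ), (0 : E))).compContinuousLinearMap (ContinuousLinearMap.inr ℝ ℝ E) -
        extDeriv (fun y => covSlice (φ (t, y))) x := by
  have hd : DifferentiableAt ℝ φ (t, x) := hφ.differentiable (by norm_num) _
  -- the slice as a function of `y` is `covSliceCLM ∘ φ ∘ (y ↦ (t, y))`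
  have hj : HasFDerivAt (fun y : E => ((t : ℝ), y)) (ContinuousLinearMap.inr ℝ ℝ E) x :=
    ((hasFDerivAt_const t x).prodMk (hasFDerivAt_id x)).congr_fderiv rfl
  have hslice : fderiv ℝ (fun y => covSlice (φ (t, y))) x =
      (covSliceCLM : ((ℝ × E) [⋀^Fin (m + 1)]→L[ℝ] F) →L[ℝ] _).comp
        ((fderiv ℝ φ (t, x)).comp (ContinuousLinearMap.inr ℝ ℝ E)) := by
    have h1 : HasFDerivAt (fun y => φ (t, y)) ((fderiv ℝ φ (t, x)).comp
        (ContinuousLinearMap.inr ℝ ℝ E)) x := hd.hasFDerivAt.comp x hj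
    exact ((covSliceCLM : ((ℝ × E) [⋀^Fin (m + 1)]→L[ℝ] F) →L[ℝ] _).hasFDerivAt.comp x h1).fderiv
  ext v
  rw [covSlice_apply, extDeriv, ContinuousAlternatingMap.alternatizeUncurryFin_apply,
    Fin.sum_univ_succ, ContinuousAlternatingMap.sub_apply, extDeriv,
    ContinuousAlternatingMap.alternatizeUncurryFin_apply]
  simp only [Fin.val_zero, pow_zero, one_smul, Fin.cons_zero, Fin.val_succ, pow_succ,
    Fin.cons_succ, Fin.removeNth_zero_cons, Fin.removeNth_succ_cons,
    ContinuousAlternatingMap.compContinuousLinearMap_apply]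
  rw [sub_eq_add_neg, ← Finset.sum_neg_distrib]
  congr 1
  refine Finset.sum_congr rfl fun j _ => ?_
  rw [hslice, mul_neg_one, neg_smul]
  rfl

end CovSlice


/-! ### The cylinder `ℝ × Ω`, slices of test forms through a linear map, the product current -/

section Cylinder

variable {E : Type*} [NormedAddCommGroup E] [NormedSpace ℝ E] {Ω : Opens E} {m k : ℕ}

variable (Ω) in
/-- The cylinder `ℝ × Ω` as an open subset of `ℝ × E`. [cite: Federer1969, 4.1.8] -/
def cylinder : Opens (ℝ × E) := ⟨univ ×ˢ (Ω : Set E), isOpen_univ.prod Ω.isOpen⟩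

omit [NormedSpace ℝ E] in
/-- The carrier of the cylinder. [folklore] -/
theorem coe_cylinder : ((cylinder Ω : Opens (ℝ × E)) : Set (ℝ × E)) = univ ×ˢ (Ω : Set E) := rfl

omit [NormedSpace ℝ E] in
/-- The support of a time slice sits in the projection of the support. [folklore] -/
theorem tsupport_comp_slice_subset {F : Type*} [Zero F] [TopologicalSpace F] (φ : ℝ × E → F)
    (hφ : HasCompactSupport φ) (t : ℝ) :
    tsupport (fun x => φ (t, x)) ⊆ Prod.snd '' tsupport φ := by
  refine closure_minimal (fun x hx => ⟨(t, x), subset_tsupport _ hx, rfl⟩) ?_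
  exact (hφ.isCompact.image continuous_snd).isClosed

/-- The projection of the support of a test form on the cylinder is a compact subset of `Ω`.
[folklore] -/
theorem snd_image_tsupport_subset (φ : TestForm (cylinder Ω) (m + 1)) :
    Prod.snd '' tsupport ⇑φ ⊆ (Ω : Set E) := by
  rintro _ ⟨p, hp, rfl⟩
  have := φ.tsupport_subset hp
  rw [coe_cylinder] at this
  exact this.2

omit [NormedAddCommGroup E] [NormedSpace ℝ E] in
/-- The support of `x ↦ L (φ(t,x))` lies in that of `x ↦ φ(t,x)`. [folklore] -/
theorem support_clm_comp_slice_subset {E F G : Type*} [NormedAddCommGroup F] [NormedSpace ℝ F]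
    [NormedAddCommGroup G] [NormedSpace ℝ G] (L : F →L[ℝ] G) (φ : ℝ × E → F) (t : ℝ) :
    support (fun x => L (φ (t, x))) ⊆ support fun x => φ (t, x) := by
  intro x hx
  contrapose! hx
  rw [notMem_support] at hx ⊢
  rw [hx, map_zero]

/-- **Slices of test forms on the cylinder through a linear map `L` on covectors**:
`(sliceBy L φ t)(x) = L (φ(t, x))`, a test form on `Ω`. The two instances used below are the
*time slice* `φ^t` (`L = covSliceCLM`: contract with `e₀`, restrict to `E`) and the *pull-back to the
slice* `j_t^* φ` (`L = (· ∘ ⋀ inr)`). [cite: Federer1969, 4.1.8] -/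
def TestForm.sliceBy (L : Covector (ℝ × E) (m + 1) →L[ℝ] Covector E k)
    (φ : TestForm (cylinder Ω) (m + 1)) (t : ℝ) : TestForm Ω k :=
  ⟨fun x => L (φ (t, x)),
    L.contDiff.comp (φ.contDiff.comp (contDiff_const.prodMk contDiff_id)),
    (φ.hasCompactSupport.isCompact.image continuous_snd).of_isClosed_subset (isClosed_tsupport _)
      ((closure_mono (support_clm_comp_slice_subset L (⇑φ) t)).trans
        (tsupport_comp_slice_subset (⇑φ) φ.hasCompactSupport t)),
    ((closure_mono (support_clm_comp_slice_subset L (⇑φ) t)).trans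
        (tsupport_comp_slice_subset (⇑φ) φ.hasCompactSupport t)).trans (snd_image_tsupport_subset φ)⟩

/-- Formula for `sliceBy`. [folklore] -/
@[simp] theorem TestForm.sliceBy_apply (L : Covector (ℝ × E) (m + 1) →L[ℝ] Covector E k)
    (φ : TestForm (cylinder Ω) (m + 1)) (t : ℝ) (x : E) :
    TestForm.sliceBy L φ t x = L (φ (t, x)) := rfl

/-- Slices are supported in the projection of the support. [folklore] -/
theorem TestForm.tsupport_sliceBy_subset (L : Covector (ℝ × E) (m + 1) →L[ℝ] Covector E k)
    (φ : TestForm (cylinder Ω) (m + 1)) (t : ℝ) :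
    tsupport ⇑(TestForm.sliceBy L φ t) ⊆ Prod.snd '' tsupport ⇑φ :=
  (closure_mono (support_clm_comp_slice_subset L (⇑φ) t)).trans
    (tsupport_comp_slice_subset (⇑φ) φ.hasCompactSupport t)

/-- `sliceBy` is additive in the form. [folklore] -/
theorem TestForm.sliceBy_add (L : Covector (ℝ × E) (m + 1) →L[ℝ] Covector E k)
    (φ ψ : TestForm (cylinder Ω) (m + 1)) (t : ℝ) :
    TestForm.sliceBy L (φ + ψ) t = TestForm.sliceBy L φ t + TestForm.sliceBy L ψ t := by
  apply TestFunction.ext; intro x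
  show L ((φ + ψ) (t, x)) = L (φ (t, x)) + L (ψ (t, x))
  rw [add_apply, map_add]

/-- `sliceBy` is homogeneous in the form. [folklore] -/
theorem TestForm.sliceBy_smul (L : Covector (ℝ × E) (m + 1) →L[ℝ] Covector E k) (c : ℝ)
    (φ : TestForm (cylinder Ω) (m + 1)) (t : ℝ) :
    TestForm.sliceBy L (c • φ) t = c • TestForm.sliceBy L φ t := by
  apply TestFunction.ext; intro x
  show L ((c • φ) (t, x)) = c • L (φ (t, x))
  rw [smul_apply, map_smul]

/-- `sliceBy` is linear in `L`: differences. [folklore] -/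
theorem TestForm.sliceBy_sub_left (L L' : Covector (ℝ × E) (m + 1) →L[ℝ] Covector E k)
    (φ : TestForm (cylinder Ω) (m + 1)) (t : ℝ) :
    TestForm.sliceBy (L - L') φ t = TestForm.sliceBy L φ t - TestForm.sliceBy L' φ t := by
  apply TestFunction.ext; intro x; rfl

end Cylinder

/-! ### Slices on the steps `𝓓_K` and seminorm estimates -/

section SliceSupported

variable {E : Type*} [NormedAddCommGroup E] [NormedSpace ℝ E] {Ω : Opens E} {m k : ℕ}

/-- The projection of a compact subset of `ℝ × E`. [folklore] -/
def cylSnd (K : Compacts (ℝ × E)) : Compacts E :=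
  ⟨Prod.snd '' (K : Set (ℝ × E)), K.isCompact.image continuous_snd⟩

omit [NormedSpace ℝ E] in
/-- The projection of a compact subset of the cylinder lies in `Ω`. [folklore] -/
theorem cylSnd_subset {K : Compacts (ℝ × E)} (hK : (K : Set (ℝ × E)) ⊆ cylinder Ω) :
    (cylSnd K : Set E) ⊆ (Ω : Set E) := by
  rintro _ ⟨p, hp, rfl⟩
  have := hK hp
  rw [coe_cylinder] at this
  exact this.2

/-- The slice of `φ ∈ 𝓓_K̃(ℝ × E)` as an element of `𝓓_{snd K̃}(E)`. [folklore] -/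
def sliceByD (L : Covector (ℝ × E) (m + 1) →L[ℝ] Covector E k) {K : Compacts (ℝ × E)}
    (φ : 𝓓_{K}(ℝ × E, Covector (ℝ × E) (m + 1))) (t : ℝ) : 𝓓_{(cylSnd K)}(E, Covector E k) :=
  ⟨fun x => L (φ (t, x)),
    L.contDiff.comp (φ.contDiff.comp (contDiff_const.prodMk contDiff_id)),
    fun x hx => by
      have hx' : (t, x) ∉ (K : Set (ℝ × E)) := fun h => hx ⟨(t, x), h, rfl⟩
      simp only [Pi.zero_apply]
      rw [show φ (t, x) = 0 from φ.zero_on_compl hx', map_zero]⟩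

/-- Slicing commutes with the inclusions `𝓓_K → 𝓓`. [folklore] -/
theorem TestForm.sliceBy_ofSupportedIn (L : Covector (ℝ × E) (m + 1) →L[ℝ] Covector E k)
    {K : Compacts (ℝ × E)} (hK : (K : Set (ℝ × E)) ⊆ cylinder Ω)
    (φ : 𝓓_{K}(ℝ × E, Covector (ℝ × E) (m + 1))) (t : ℝ) :
    TestForm.sliceBy L (TestFunction.ofSupportedIn hK φ : TestForm (cylinder Ω) (m + 1)) t =
      TestFunction.ofSupportedIn (cylSnd_subset hK) (sliceByD L φ t) := rfl

variable (E m k) in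
/-- The operator `M ↦ L ∘ (M ∘ (inr,…,inr))` on `i`-multilinear maps, through which the
`x`-derivatives of a slice factor. [folklore] -/
def sliceDerivCLM (L : Covector (ℝ × E) (m + 1) →L[ℝ] Covector E k) (i : ℕ) :
    ContinuousMultilinearMap ℝ (fun _ : Fin i => ℝ × E) (Covector (ℝ × E) (m + 1)) →L[ℝ]
      ContinuousMultilinearMap ℝ (fun _ : Fin i => E) (Covector E k) :=
  (ContinuousLinearMap.compContinuousMultilinearMapL ℝ (fun _ : Fin i => E)
      (Covector (ℝ × E) (m + 1)) (Covector E k) L).comp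
    (ContinuousMultilinearMap.compContinuousLinearMapL fun _ => ContinuousLinearMap.inr ℝ ℝ E)

/-- Formula for `sliceDerivCLM`. [folklore] -/
theorem sliceDerivCLM_apply (L : Covector (ℝ × E) (m + 1) →L[ℝ] Covector E k) (i : ℕ)
    (M : ContinuousMultilinearMap ℝ (fun _ : Fin i => ℝ × E) (Covector (ℝ × E) (m + 1))) :
    sliceDerivCLM E m k L i M =
      L.compContinuousMultilinearMap
        (M.compContinuousLinearMap fun _ => ContinuousLinearMap.inr ℝ ℝ E) := rfl

/-- `‖sliceDerivCLM L i M‖ ≤ ‖L‖ ‖M‖`. [folklore] -/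
theorem norm_sliceDerivCLM_apply_le (L : Covector (ℝ × E) (m + 1) →L[ℝ] Covector E k) (i : ℕ)
    (M : ContinuousMultilinearMap ℝ (fun _ : Fin i => ℝ × E) (Covector (ℝ × E) (m + 1))) :
    ‖sliceDerivCLM E m k L i M‖ ≤ ‖L‖ * ‖M‖ := by
  rw [sliceDerivCLM_apply]
  calc _ ≤ ‖L‖ * ‖M.compContinuousLinearMap fun _ => ContinuousLinearMap.inr ℝ ℝ E‖ :=
        ContinuousLinearMap.norm_compContinuousMultilinearMap_le _ _
    _ ≤ ‖L‖ * (‖M‖ * ∏ _j : Fin i, ‖ContinuousLinearMap.inr ℝ ℝ E‖) :=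
        mul_le_mul_of_nonneg_left (ContinuousMultilinearMap.norm_compContinuousLinearMap_le _ _)
          (norm_nonneg L)
    _ ≤ ‖L‖ * (‖M‖ * 1) := by
        refine mul_le_mul_of_nonneg_left (mul_le_mul_of_nonneg_left ?_ (by positivity))
          (norm_nonneg L)
        exact Finset.prod_le_one (fun _ _ => norm_nonneg _)
          fun _ _ => ContinuousLinearMap.norm_inr_le_one ℝ ℝ E
    _ = ‖L‖ * ‖M‖ := by ring

/-- **`x`-derivatives of a slice, as an identity**:
`D^i(x ↦ L φ(t,x))(x) = L ∘ (D^iφ(t,x) ∘ (inr, …, inr))`. [folklore] -/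
theorem iteratedFDeriv_clm_comp_slice (L : Covector (ℝ × E) (m + 1) →L[ℝ] Covector E k)
    (φ : ℝ × E → Covector (ℝ × E) (m + 1)) (hφ : ContDiff ℝ ∞ φ) (t : ℝ) (i : ℕ) (x : E) :
    iteratedFDeriv ℝ i (fun y => L (φ (t, y))) x = sliceDerivCLM E m k L i (iteratedFDeriv ℝ i φ (t, x)) := by
  have h1 : (fun y => L (φ (t, y))) =
      L ∘ ((fun z : ℝ × E => φ (z + ((t : ℝ), (0 : E)))) ∘ (ContinuousLinearMap.inr ℝ ℝ E)) := by
    funext y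
    simp [Prod.mk_add_mk]
  have hf : ContDiff ℝ ∞ fun z : ℝ × E => φ (z + ((t : ℝ), (0 : E))) :=
    hφ.comp (contDiff_id.add contDiff_const)
  have hg : ContDiff ℝ ∞ ((fun z : ℝ × E => φ (z + ((t : ℝ), (0 : E)))) ∘
      (ContinuousLinearMap.inr ℝ ℝ E)) := hf.comp (ContinuousLinearMap.inr ℝ ℝ E).contDiff
  rw [h1, L.iteratedFDeriv_comp_left hg.contDiffAt (mod_cast le_top),
    (ContinuousLinearMap.inr ℝ ℝ E).iteratedFDeriv_comp_right hf x (mod_cast le_top),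
    iteratedFDeriv_comp_add_right, ContinuousLinearMap.inr_apply, Prod.mk_add_mk, zero_add,
    add_zero, sliceDerivCLM_apply]

/-- **Seminorm estimate for slices**: `N_{snd K̃, i}(sliceByD L φ t) ≤ ‖L‖ N_{K̃, i}(φ)`. [folklore] -/
theorem seminorm_sliceByD_le (L : Covector (ℝ × E) (m + 1) →L[ℝ] Covector E k)
    {K : Compacts (ℝ × E)} (φ : 𝓓_{K}(ℝ × E, Covector (ℝ × E) (m + 1))) (t : ℝ) (i : ℕ) :
    ContDiffMapSupportedIn.seminorm ℝ E (Covector E k) ⊤ (cylSnd K) i (sliceByD L φ t) ≤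
      ‖L‖ * ContDiffMapSupportedIn.seminorm ℝ (ℝ × E) (Covector (ℝ × E) (m + 1)) ⊤ K i φ := by
  rw [ContDiffMapSupportedIn.seminorm_top_le_iff ℝ (by positivity)]
  intro x _
  change ‖iteratedFDeriv ℝ i (fun y => L (φ (t, y))) x‖ ≤ _
  rw [iteratedFDeriv_clm_comp_slice L (⇑φ) φ.contDiff t i x]
  exact (norm_sliceDerivCLM_apply_le L i _).trans (mul_le_mul_of_nonneg_left
    (ContDiffMapSupportedIn.norm_iteratedFDeriv_apply_le_seminorm ℝ (mod_cast le_top)) (norm_nonneg L))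

/-- **Seminorms of differences of slices at two times**: if `‖D^iφ(t,x) − D^iφ(t',x)‖ ≤ ε` for all
`x` then `N_i(sliceByD L φ t − sliceByD L φ t') ≤ ‖L‖ ε`. [folklore] -/
theorem seminorm_sliceByD_sub_le (L : Covector (ℝ × E) (m + 1) →L[ℝ] Covector E k)
    {K : Compacts (ℝ × E)} (φ : 𝓓_{K}(ℝ × E, Covector (ℝ × E) (m + 1))) (t t' : ℝ) (i : ℕ)
    {ε : ℝ} (hε : 0 ≤ ε)
    (h : ∀ x : E, ‖iteratedFDeriv ℝ i (⇑φ) (t, x) - iteratedFDeriv ℝ i (⇑φ) (t', x)‖ ≤ ε) :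
    ContDiffMapSupportedIn.seminorm ℝ E (Covector E k) ⊤ (cylSnd K) i
      (sliceByD L φ t - sliceByD L φ t') ≤ ‖L‖ * ε := by
  rw [ContDiffMapSupportedIn.seminorm_top_le_iff ℝ (by positivity)]
  intro x _
  have hs : ∀ τ : ℝ, ContDiff ℝ ∞ (fun y => L (φ (τ, y))) := fun τ =>
    L.contDiff.comp (φ.contDiff.comp (contDiff_const.prodMk contDiff_id))
  change ‖iteratedFDeriv ℝ i ((fun y => L (φ (t, y))) - (fun y => L (φ (t', y)))) x‖ ≤ _
  rw [iteratedFDeriv_sub ((hs t).of_le (mod_cast le_top)) ((hs t').of_le (mod_cast le_top)),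
    Pi.sub_apply, iteratedFDeriv_clm_comp_slice L (⇑φ) φ.contDiff t i x,
    iteratedFDeriv_clm_comp_slice L (⇑φ) φ.contDiff t' i x, ← map_sub]
  exact (norm_sliceDerivCLM_apply_le L i _).trans (mul_le_mul_of_nonneg_left (h x) (norm_nonneg L))

/-- **A current is bounded by finitely many seminorms on each `𝓓_K`** (continuity on the steps of
the inductive limit). [cite: Federer1969, 4.1.7] -/
theorem Current.exists_seminorm_bound (T : Current Ω m) {K : Compacts E}
    (hK : (K : Set E) ⊆ (Ω : Set E)) :
    ∃ (s : Finset ℕ) (C : ℝ≥0), ∀ ψ : 𝓓_{K}(E, Covector E m),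
      |T (TestFunction.ofSupportedIn hK ψ)| ≤
        C * (s.sup (ContDiffMapSupportedIn.seminorm ℝ E (Covector E m) ⊤ K)) ψ := by
  let L : 𝓓_{K}(E, Covector E m) →L[ℝ] ℝ := T.comp (TestFunction.ofSupportedInCLM ℝ hK)
  let q : Seminorm ℝ 𝓓_{K}(E, Covector E m) := (normSeminorm ℝ ℝ).comp L.toLinearMap
  have hq : Continuous q := continuous_norm.comp L.continuous
  obtain ⟨s, C, -, hle⟩ := Seminorm.bound_of_continuous
    (ContDiffMapSupportedIn.withSeminorms ℝ E (Covector E m) ⊤ K) q hq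
  refine ⟨s, C, fun ψ => ?_⟩
  have := hle ψ
  rw [smul_apply, NNReal.smul_def, smul_eq_mul] at this
  exact this

/-- The derivatives of `φ ∈ 𝓓_K̃` are uniformly continuous (continuous with compact support).
[folklore] -/
theorem uniformContinuous_iteratedFDeriv_supportedIn {X F : Type*}
    [NormedAddCommGroup X] [NormedSpace ℝ X] [NormedAddCommGroup F] [NormedSpace ℝ F]
    {K : Compacts X} (φ : 𝓓_{K}(X, F)) (i : ℕ) :
    UniformContinuous (iteratedFDeriv ℝ i (⇑φ)) := by
  refine HasCompactSupport.uniformContinuous_of_continuous ?_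
    (φ.contDiff.continuous_iteratedFDeriv (mod_cast le_top))
  exact HasCompactSupport.intro K.isCompact fun x hx => φ.iteratedFDeriv_zero_on_compl hx

/-- **Continuity of `t ↦ T(sliceBy L φ t)`** for `φ ∈ 𝓓_K̃` on the cylinder: `T` is bounded by
finitely many seminorms on `𝓓_{snd K̃}`, and each derivative of `φ` is uniformly continuous.
[cite: Federer1969, 4.1.8] -/
theorem Current.continuous_apply_sliceBy (T : Current Ω k)
    (L : Covector (ℝ × E) (m + 1) →L[ℝ] Covector E k) {K : Compacts (ℝ × E)}
    (hK : (K : Set (ℝ × E)) ⊆ cylinder Ω) (φ : 𝓓_{K}(ℝ × E, Covector (ℝ × E) (m + 1))) :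
    Continuous fun t => T (TestForm.sliceBy L (TestFunction.ofSupportedIn hK φ) t) := by
  obtain ⟨s, C, hC⟩ := T.exists_seminorm_bound (cylSnd_subset hK)
  simp_rw [TestForm.sliceBy_ofSupportedIn L hK φ]
  refine Metric.continuous_iff.2 fun t ε hε => ?_
  set ε' : ℝ := ε / (2 * ((C : ℝ) + 1) * (‖L‖ + 1)) with hε'
  have hε'pos : 0 < ε' := div_pos hε (by positivity)
  have hmod : ∀ i : ℕ, ∃ δ > 0, ∀ t' : ℝ, dist t' t < δ → ∀ x : E,
      ‖iteratedFDeriv ℝ i (⇑φ) (t', x) - iteratedFDeriv ℝ i (⇑φ) (t, x)‖ ≤ ε' := by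
    intro i
    obtain ⟨δ, hδ, hu⟩ := Metric.uniformContinuous_iff.1
      (uniformContinuous_iteratedFDeriv_supportedIn φ i) ε' hε'pos
    refine ⟨δ, hδ, fun t' ht' x => le_of_lt ?_⟩
    rw [← dist_eq_norm]
    apply hu
    rw [Prod.dist_eq, dist_self, max_eq_left dist_nonneg]
    exact ht'
  choose δf hδf hmodf using hmod
  classical
  set δ : ℝ := if hs : s.Nonempty then s.inf' hs δf else 1 with hδdef
  have hδpos : 0 < δ := by
    rw [hδdef]; split_ifs with hs
    · exact (Finset.lt_inf'_iff hs).2 fun i _ => hδf i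
    · exact one_pos
  refine ⟨δ, hδpos, fun t' ht' => ?_⟩
  have hδi : ∀ i ∈ s, dist t' t < δf i := fun i hi => by
    refine lt_of_lt_of_le ht' ?_
    rw [hδdef, dif_pos ⟨i, hi⟩]
    exact Finset.inf'_le _ hi
  have hsup : (s.sup (ContDiffMapSupportedIn.seminorm ℝ E (Covector E k) ⊤ (cylSnd K)))
      (sliceByD L φ t' - sliceByD L φ t) ≤ ‖L‖ * ε' :=
    Seminorm.finset_sup_apply_le (by positivity) fun i hi =>
      seminorm_sliceByD_sub_le L φ t' t i hε'pos.le (hmodf i t' (hδi i hi))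
  rw [Real.dist_eq, ← map_sub, show TestFunction.ofSupportedIn (cylSnd_subset hK) (sliceByD L φ t') -
      TestFunction.ofSupportedIn (cylSnd_subset hK) (sliceByD L φ t) =
      TestFunction.ofSupportedIn (cylSnd_subset hK) (sliceByD L φ t' - sliceByD L φ t) from rfl]
  calc |T (TestFunction.ofSupportedIn (cylSnd_subset hK) (sliceByD L φ t' - sliceByD L φ t))|
      ≤ C * (s.sup (ContDiffMapSupportedIn.seminorm ℝ E (Covector E k) ⊤ (cylSnd K)))
          (sliceByD L φ t' - sliceByD L φ t) := hC _
    _ ≤ C * (‖L‖ * ε') := mul_le_mul_of_nonneg_left hsup C.coe_nonneg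
    _ < ε := by
        rw [hε']
        have hC0 : (0 : ℝ) ≤ C := C.coe_nonneg
        have hL0 : 0 ≤ ‖L‖ := norm_nonneg L
        rw [show (C : ℝ) * (‖L‖ * (ε / (2 * ((C : ℝ) + 1) * (‖L‖ + 1)))) =
          ε * (C * ‖L‖ / (2 * ((C : ℝ) + 1) * (‖L‖ + 1))) by ring]
        have h1 : (C : ℝ) * ‖L‖ / (2 * ((C : ℝ) + 1) * (‖L‖ + 1)) < 1 := by
          rw [div_lt_one (by positivity)]
          nlinarith [mul_nonneg hC0 hL0]
        nlinarith [mul_nonneg hC0 hL0, div_nonneg (mul_nonneg hC0 hL0)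
          (show (0:ℝ) ≤ 2 * ((C : ℝ) + 1) * (‖L‖ + 1) by positivity)]

/-- Every test function is the image of itself viewed in `𝓓_{spt φ}`. [folklore] -/
def TestFunction.toSupportedIn {X F : Type*} [NormedAddCommGroup X] [NormedSpace ℝ X]
    [NormedAddCommGroup F] [NormedSpace ℝ F] {U : Opens X} (φ : 𝓓(U, F)) :
    𝓓_{(⟨tsupport ⇑φ, φ.hasCompactSupport⟩ : Compacts X)}(X, F) :=
  ⟨φ, φ.contDiff, fun _ hx => image_eq_zero_of_notMem_tsupport hx⟩

/-- `ofSupportedIn (toSupportedIn φ) = φ`. [folklore] -/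
theorem TestFunction.ofSupportedIn_toSupportedIn {X F : Type*} [NormedAddCommGroup X]
    [NormedSpace ℝ X] [NormedAddCommGroup F] [NormedSpace ℝ F] {U : Opens X} (φ : 𝓓(U, F)) :
    TestFunction.ofSupportedIn (K := ⟨tsupport ⇑φ, φ.hasCompactSupport⟩) φ.tsupport_subset
      (TestFunction.toSupportedIn φ) = φ := rfl

/-- **`t ↦ T(sliceBy L φ t)` is continuous** for every test form `φ` on the cylinder.
[cite: Federer1969, 4.1.8] -/
theorem Current.continuous_apply_sliceBy' (T : Current Ω k)
    (L : Covector (ℝ × E) (m + 1) →L[ℝ] Covector E k) (φ : TestForm (cylinder Ω) (m + 1)) :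
    Continuous fun t => T (TestForm.sliceBy L φ t) :=
  T.continuous_apply_sliceBy L (K := ⟨tsupport ⇑φ, φ.hasCompactSupport⟩) φ.tsupport_subset
    (TestFunction.toSupportedIn φ)

/-- `t ↦ T(sliceBy L φ t)` is interval integrable. [folklore] -/
theorem Current.intervalIntegrable_apply_sliceBy (T : Current Ω k)
    (L : Covector (ℝ × E) (m + 1) →L[ℝ] Covector E k) (φ : TestForm (cylinder Ω) (m + 1))
    (a b : ℝ) : IntervalIntegrable (fun t => T (TestForm.sliceBy L φ t)) volume a b :=
  (T.continuous_apply_sliceBy' L φ).intervalIntegrable a b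

/-- **The bound `|T(sliceBy L φ t)| ≤ C ‖L‖ (s.sup N_K̃)(φ)` on `𝓓_K̃`.** [cite: Federer1969, 4.1.8] -/
theorem Current.abs_apply_sliceBy_le (T : Current Ω k)
    (L : Covector (ℝ × E) (m + 1) →L[ℝ] Covector E k) {K : Compacts (ℝ × E)}
    (hK : (K : Set (ℝ × E)) ⊆ cylinder Ω) {s : Finset ℕ} {C : ℝ≥0}
    (hC : ∀ ψ : 𝓓_{(cylSnd K)}(E, Covector E k),
      |T (TestFunction.ofSupportedIn (cylSnd_subset hK) ψ)| ≤
        C * (s.sup (ContDiffMapSupportedIn.seminorm ℝ E (Covector E k) ⊤ (cylSnd K))) ψ)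
    (φ : 𝓓_{K}(ℝ × E, Covector (ℝ × E) (m + 1))) (t : ℝ) :
    |T (TestForm.sliceBy L (TestFunction.ofSupportedIn hK φ) t)| ≤
      (C * ‖L‖) * (s.sup (ContDiffMapSupportedIn.seminorm ℝ (ℝ × E)
        (Covector (ℝ × E) (m + 1)) ⊤ K)) φ := by
  rw [TestForm.sliceBy_ofSupportedIn L hK φ t, mul_assoc]
  refine (hC _).trans (mul_le_mul_of_nonneg_left ?_ C.coe_nonneg)
  refine Seminorm.finset_sup_apply_le (by positivity) fun i hi => ?_
  exact (seminorm_sliceByD_le L φ t i).trans (mul_le_mul_of_nonneg_left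
    (Seminorm.le_finset_sup_apply hi) (norm_nonneg L))

end SliceSupported

/-! ### The product current `[a, b] × T` -/

section ProductCurrent

variable {E : Type*} [NormedAddCommGroup E] [NormedSpace ℝ E] {Ω : Opens E} {m : ℕ}

/-- The time slice `φ^t = sliceBy covSliceCLM φ t` of a test form on the cylinder:
`φ^t(x) = φ(t,x)(e₀, ·)|_E`. [cite: Federer1969, 4.1.8] -/
abbrev TestForm.tslice (φ : TestForm (cylinder Ω) (m + 1)) (t : ℝ) : TestForm Ω m :=
  TestForm.sliceBy (covSliceCLM (E := E) (F := ℝ) (m := m)) φ t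

/-- Formula: `φ^t(x) = covSlice (φ(t,x))`. [folklore] -/
theorem TestForm.tslice_apply (φ : TestForm (cylinder Ω) (m + 1)) (t : ℝ) (x : E) :
    TestForm.tslice φ t x = covSlice (φ (t, x)) := rfl

/-- The value of the product current on a test form: `∫_a^b T(φ^t) dt`. [cite: Federer1969, 4.1.8] -/
def Current.prodIntervalFun (a b : ℝ) (T : Current Ω m) (φ : TestForm (cylinder Ω) (m + 1)) : ℝ :=
  ∫ t in a..b, T (TestForm.tslice φ t)

/-- Additivity of `prodIntervalFun`. [folklore] -/
theorem Current.prodIntervalFun_add (a b : ℝ) (T : Current Ω m) (φ ψ : TestForm (cylinder Ω) (m + 1)) :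
    T.prodIntervalFun a b (φ + ψ) = T.prodIntervalFun a b φ + T.prodIntervalFun a b ψ := by
  unfold Current.prodIntervalFun TestForm.tslice
  simp_rw [TestForm.sliceBy_add, map_add]
  exact intervalIntegral.integral_add (T.intervalIntegrable_apply_sliceBy _ φ a b)
    (T.intervalIntegrable_apply_sliceBy _ ψ a b)

/-- Homogeneity of `prodIntervalFun`. [folklore] -/
theorem Current.prodIntervalFun_smul (a b : ℝ) (T : Current Ω m) (c : ℝ)
    (φ : TestForm (cylinder Ω) (m + 1)) :
    T.prodIntervalFun a b (c • φ) = c • T.prodIntervalFun a b φ := by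
  unfold Current.prodIntervalFun TestForm.tslice
  simp_rw [TestForm.sliceBy_smul, map_smul, smul_eq_mul]
  exact intervalIntegral.integral_const_mul c _

/-- **The bound `|∫_a^b T(φ^t) dt| ≤ |b − a| C (s.sup N_K̃)(φ)` on `𝓓_K̃`.** [cite: Federer1969, 4.1.8] -/
theorem Current.abs_prodIntervalFun_le (a b : ℝ) (T : Current Ω m) {K : Compacts (ℝ × E)}
    (hK : (K : Set (ℝ × E)) ⊆ cylinder Ω) {s : Finset ℕ} {C : ℝ≥0}
    (hC : ∀ ψ : 𝓓_{(cylSnd K)}(E, Covector E m),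
      |T (TestFunction.ofSupportedIn (cylSnd_subset hK) ψ)| ≤
        C * (s.sup (ContDiffMapSupportedIn.seminorm ℝ E (Covector E m) ⊤ (cylSnd K))) ψ)
    (φ : 𝓓_{K}(ℝ × E, Covector (ℝ × E) (m + 1))) :
    |T.prodIntervalFun a b (TestFunction.ofSupportedIn hK φ)| ≤
      (|b - a| * (C * ‖(covSliceCLM (E := E) (F := ℝ) (m := m))‖)) *
        (s.sup (ContDiffMapSupportedIn.seminorm ℝ (ℝ × E) (Covector (ℝ × E) (m + 1)) ⊤ K)) φ := by
  unfold Current.prodIntervalFun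
  have hb := fun t (_ : t ∈ Set.uIoc a b) =>
    T.abs_apply_sliceBy_le (covSliceCLM (E := E) (F := ℝ) (m := m)) hK hC φ t
  have := intervalIntegral.norm_integral_le_of_norm_le_const (a := a) (b := b)
    (f := fun t => T (TestForm.tslice (TestFunction.ofSupportedIn hK φ) t)) hb
  rw [Real.norm_eq_abs] at this
  linarith [this]

/-- **The product current `[a, b] × T ∈ 𝒟_{m+1}(ℝ × Ω)`** [Federer1969, 4.1.8: the cartesian product
of the current `[a, b] ∈ 𝒟_1(ℝ)` with `T`]: `([a, b] × T)(φ) = ∫_a^b T(φ^t) dt`, where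
`φ^t(x) = φ(t,x)(e₀, ·)|_E` is the time slice. Continuity on `𝒟_K̃`: the value is bounded by
`|b − a|` times the bound of `T` on `𝒟_{snd K̃}`. [cite: Federer1969, 4.1.8] -/
def Current.prodInterval (a b : ℝ) (T : Current Ω m) : Current (cylinder Ω) (m + 1) :=
  TestFunction.mkCLM ℝ (T.prodIntervalFun a b) (T.prodIntervalFun_add a b)
    (T.prodIntervalFun_smul a b) fun K hK => by
      obtain ⟨s, C, hC⟩ := T.exists_seminorm_bound (cylSnd_subset hK)
      let ℓ : 𝓓_{K}(ℝ × E, Covector (ℝ × E) (m + 1)) →ₗ[ℝ] ℝ :=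
        { toFun := fun φ => T.prodIntervalFun a b (TestFunction.ofSupportedInCLM ℝ hK φ)
          map_add' := fun φ ψ => by rw [map_add]; exact T.prodIntervalFun_add a b _ _
          map_smul' := fun c φ => by rw [map_smul]; exact T.prodIntervalFun_smul a b c _ }
      have hcont : Continuous ℓ :=
        WithSeminorms.continuous_of_isBounded
          (ContDiffMapSupportedIn.withSeminorms ℝ (ℝ × E) (Covector (ℝ × E) (m + 1)) ⊤ K)
          (norm_withSeminorms ℝ ℝ) ℓ (.of_real fun _ => ⟨s,
            |b - a| * (C * ‖(covSliceCLM (E := E) (F := ℝ) (m := m))‖), fun φ => by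
              show ‖T.prodIntervalFun a b (TestFunction.ofSupportedIn hK φ)‖ ≤ _
              rw [Real.norm_eq_abs]
              exact T.abs_prodIntervalFun_le a b hK hC φ⟩)
      exact hcont

/-- Unfolding: `([a,b] × T)(φ) = ∫_a^b T(φ^t) dt`. [cite: Federer1969, 4.1.8] -/
theorem Current.prodInterval_apply (a b : ℝ) (T : Current Ω m) (φ : TestForm (cylinder Ω) (m + 1)) :
    T.prodInterval a b φ = ∫ t in a..b, T (TestForm.tslice φ t) := rfl

end ProductCurrent

end Literature.Geometry.GeometricMeasureTheory
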